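import Literature.Geometry.Lorentzian.SuperharmonicFactor
import Literature.Geometry.Lorentzian.PositiveMassRigidityProofs
import HarnessLib

/-!
# Schoen–Yau 1979, Theorem 1: what remains after Step 1

The positive mass theorem `schoenYau_mass_nonneg` (Schoen–Yau, Comm. Math. Phys. 65 (1979),
Thm. 1; `PositiveMassRigidity.lean`) was reduced in `PositiveMassSchoenYau.lean`
(`schoenYau_mass_nonneg_of_steps`) to the two halves of its printed proof (§2, p. 48: "The proof
then involves three steps"): Step 1, the conformal perturbation to a metric with `R ≥ 0`,
`R > 0` far out and negative mass (`exists_conformal_scalarPos_of_massNeg`), and Steps 2–3, the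
non-existence of such a metric via a complete area-minimising surface (p. 49: "so that we are
assuming `R ≥ 0` on `N`, `R > 0` outside a compact subset of `N_k`, and `M < 0`"; Step 2,
pp. 49–52; Step 3, pp. 52–63). Step 1 is now a theorem
(`exists_conformal_scalarPos_of_massNeg_holds`, `SuperharmonicFactor.lean`, built on the
transformation law `conformal_scalarCurvature_law` of `ConformalChange.lean` and the superharmonic
factor (2.1)–(2.3)); this file records the resulting one-hypothesis reductions:

* `schoenYau_mass_nonneg_of_steps23` — **Theorem 1 follows from Steps 2–3 alone**;
* `positive_mass_rigidity_of_steps23` — the rigidity theorem (Thm. 2, `positive_mass_rigidity`)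
  from Steps 2–3, Cor. 3.1 (`exists_conformal_negativeMass_of_massZero`) and the Ricci variation
  (`exists_ricciVariation_negativeMass_of_massZero`), the remaining leaves of the DAG of
  `PositiveMassRigidity.lean` now that Step 1 and Greene–Wu's flat case
  (`euclidean_of_isFlat_of_isSoleEnd_holds`, `PositiveMassRigidityProofs.lean`) are proved.

Steps 2–3 are *not* a named fact of the tree: they are a slice of the printed proof of Thm. 1
(Thm. 1 under the one extra hypothesis that Step 1 delivers), not a separately stated published
result, and of the size of the theorem itself (Plateau problem in a Riemannian `3`-manifold,
curvature estimates, second variation, Gauss–Bonnet on a complete surface). Following the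
D-0026 review of that decomposition the statement is carried *written out* as the hypothesis
`h₂₃` of the two reductions (verbatim the statement formerly named
`schoenYau_mass_nonneg_of_scalarPos_far`): on boundaryless, connected, oriented, one-ended data
whose end is asymptotically Schwarzschildean of mass `M` to second order ((1.1)), with `R ≥ 0`
everywhere and `R > 0` on a far region `e.far ρ` of the end, `0 ≤ M`. The unproved published
result these reductions depend on is thus `schoenYau_mass_nonneg` (Thm. 1) itself, of which `h₂₃`
is the special case that remains to be formalised.

Everything is proved; no statement of `Prop` type is introduced.

## References

* R. Schoen, S.-T. Yau, *On the proof of the positive mass conjecture in general relativity*,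
  Comm. Math. Phys. 65 (1979) 45–76, Thms. 1–2 (p. 48), §2 (pp. 48–63), §3. [SchoenYauPMT1979]
-/

noncomputable section

open scoped ContDiff Manifold

namespace Literature.Geometry.Lorentzian

/-- **Schoen–Yau's Theorem 1 from Steps 2–3 of its proof.** With Step 1 proved
(`exists_conformal_scalarPos_of_massNeg_holds`), the positive mass theorem `schoenYau_mass_nonneg`
(Comm. Math. Phys. 65 (1979), Thm. 1) follows from the remaining half of the printed argument,
§2, Steps 2–3 (pp. 49–63), taken as the written-out hypothesis `h₂₃`: on boundaryless,
connected, oriented, one-ended data, asymptotically Schwarzschildean of mass `M` to second order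
((1.1)), with `R ≥ 0` everywhere and `R > 0` on a far region of the end, the mass is not
negative (p. 49: "so that we are assuming `R ≥ 0` on `N`, `R > 0` outside a compact subset of
`N_k`, and `M < 0`"; Step 2, p. 49: a complete area-minimising surface exists; Step 3, p. 52: it
cannot — stability, Gauss–Bonnet). By `schoenYau_mass_nonneg_of_steps`.
[cite: SchoenYauPMT1979, Thm. 1 (p. 48) and §2] -/
theorem schoenYau_mass_nonneg_of_steps23
    (h₂₃ : ∀ (X : Type) [TopologicalSpace X] [ChartedSpace E3 X] [IsManifold (𝓡 3) ∞ X]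
      [T2Space X] [SecondCountableTopology X] [ConnectedSpace X]
      (D : InitialDataSet (𝓡 3) X) [D.metric.HasLeviCivita] (e : AFEnd X) (M : ℝ),
      Literature.Topology.FourManifolds.IsOrientable (𝓡 3) X →
      IsAsymptoticallySchwarzschild e D M 2 → e.IsSoleEnd →
      (∀ x : X, 0 ≤ D.metric.scalarCurvature x) →
      (∃ ρ : ℝ, ∀ x ∈ e.far ρ, 0 < D.metric.scalarCurvature x) → 0 ≤ M) :
    schoenYau_mass_nonneg :=
  schoenYau_mass_nonneg_of_steps exists_conformal_scalarPos_of_massNeg_holds h₂₃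

/-- **The rigidity theorem from the three remaining leaves.** `positive_mass_rigidity`
(Schoen–Yau 1979, Thm. 2) follows from Steps 2–3 of the proof of Thm. 1 (the written-out
hypothesis `h₂₃`, as in `schoenYau_mass_nonneg_of_steps23`), Cor. 3.1
(`exists_conformal_negativeMass_of_massZero`) and the Ricci variation (3.24)–(3.30)
(`exists_ricciVariation_negativeMass_of_massZero`); the other two leaves of
`positive_mass_rigidity_of_steps'` are the theorems `exists_conformal_scalarPos_of_massNeg_holds`
(Step 1) and `euclidean_of_isFlat_of_isSoleEnd_holds` (Greene–Wu, flat case).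
[cite: SchoenYauPMT1979, Thms. 1–2 (p. 48), §2 and §3] -/
theorem positive_mass_rigidity_of_steps23
    (h₂₃ : ∀ (X : Type) [TopologicalSpace X] [ChartedSpace E3 X] [IsManifold (𝓡 3) ∞ X]
      [T2Space X] [SecondCountableTopology X] [ConnectedSpace X]
      (D : InitialDataSet (𝓡 3) X) [D.metric.HasLeviCivita] (e : AFEnd X) (M : ℝ),
      Literature.Topology.FourManifolds.IsOrientable (𝓡 3) X →
      IsAsymptoticallySchwarzschild e D M 2 → e.IsSoleEnd →
      (∀ x : X, 0 ≤ D.metric.scalarCurvature x) →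
      (∃ ρ : ℝ, ∀ x ∈ e.far ρ, 0 < D.metric.scalarCurvature x) → 0 ≤ M)
    (hc : exists_conformal_negativeMass_of_massZero)
    (hv : exists_ricciVariation_negativeMass_of_massZero) : positive_mass_rigidity :=
  positive_mass_rigidity_of_steps' exists_conformal_scalarPos_of_massNeg_holds h₂₃ hc hv
    euclidean_of_isFlat_of_isSoleEnd_holds

/-- **The rigidity theorem from its three remaining NAMED-FACT leaves** (fact decomposition of
`positive_mass_rigidity`, librarian sweep `libsplit-39`, 2026-08-16). Schoen–Yau 1979, Thm. 2
(`positive_mass_rigidity`) follows from exactly three undischarged named facts of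
`PositiveMassRigidity.lean`, each a distinct printed result of the source: Thm. 1, the positive
mass theorem in Schoen–Yau's expansion form (`schoenYau_mass_nonneg`; itself reduced to Steps 2–3
of its proof by `schoenYau_mass_nonneg_of_steps23` above and further in
`PositiveMassSchoenYauSurfaceReduction.lean`), Cor. 3.1 (`exists_conformal_negativeMass_of_massZero`)
and the Ricci variation (3.24)–(3.30) (`exists_ricciVariation_negativeMass_of_massZero`). All other
steps of the printed proof are theorems of the tree: `R ≡ 0` and `Ric ≡ 0` from these
(`scalarFlat_of_massZero_of_facts`, `ricciFlat_of_scalarFlat_of_massZero_of_facts`), flatness in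
dimension three (`isFlat_of_isRicciFlat_three_holds`), completeness of one-ended data
(`isComplete_of_isSoleEnd_holds`) and Greene–Wu's flat case
(`euclidean_of_isFlat_of_isSoleEnd_holds`). So `positive_mass_rigidity_holds` will read
`positive_mass_rigidity_holds_of schoenYau_mass_nonneg_holds exists_conformal_negativeMass_of_massZero_holds
exists_ricciVariation_negativeMass_of_massZero_holds`. [cite: SchoenYauPMT1979, Thms. 1–2 (p. 48), Cor. 3.1 and (3.24)–(3.30) (pp. 71–74)] -/
theorem positive_mass_rigidity_holds_of (h₀ : schoenYau_mass_nonneg)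
    (hc : exists_conformal_negativeMass_of_massZero)
    (hv : exists_ricciVariation_negativeMass_of_massZero) : positive_mass_rigidity :=
  positive_mass_rigidity_of_source_facts''' h₀ hc hv isComplete_of_isSoleEnd_holds
    euclidean_of_isFlat_of_isSoleEnd_holds

end Literature.Geometry.Lorentzian

end
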